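import Summits.KontsevichZagierPeriods.KontsevichZagierPeriods.Theorems.SymplecticScissorsRealOnePeriodRelationsIsoLayer

/-!
# Crux `RealOnePeriodRelations` (stmt-KontsevichZagierPeriods-10042), line `nash-retraction-thin-strip`, reshape 5
# (the unconditional LOOP layer): stub `stub_loopCells` — CELLS

The loop layer of the crux realises COMPLETE real elliptic integrals by closed paths (loops) on affine Weierstrass
curves, so that the tree's proved closed-path sectors of Huber–Wüstholz 13.3 (2) (complex multiplication allowed) apply.
Its generators are (i) polynomial cells `[∫_{(a,b)} P]` (`a < b` real algebraic, `P ∈ (ℚ̄ ∩ ℝ)[x]`), (ii) oval cells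
`[∫_{(e₁,e₂)} (P₁ + P₂√f + P₃/√f)]` over consecutive real roots `e₁ < e₂` of `f = x³ + Ax + B`, and (iii) branch cells
`[∫_{(e,∞)} c₀/√f]` over the largest real root.  The CELLS step of the sector glue (`SectorGlue.realOnePeriodRelations_of_sector`)
reduces every `ℤ`-combination of generators, modulo `M₁`, to a `ℤ`-combination of polynomial cells, ODD oval cells
(`P₁ = 0`) and branch cells: the only work is rule 1b, splitting `P₁` off an oval cell (`exists_split_poly`).
[cite: KontsevichZagier2001, §1.2 rule (1)] [cite: HuberWustholz2022, Thm 13.3 (2)]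
-/

noncomputable section

open scoped BigOperators Polynomial
open Set MeasureTheory MvPolynomial
open Literature.NumberTheory.Transcendental Literature.NumberTheory.Transcendental.CurvePeriods
open Summit.KontsevichZagierPeriods.SymplecticScissors.RealOnePeriodRelationsNegative (M₁ H₁ crux_iff unitDom)

namespace Summit.KontsevichZagierPeriods.SymplecticScissors.RealOnePeriodRelations

namespace LoopLayer

/-- `z ↦ P(z 0)` is `ℚ`-semialgebraic on a semialgebraic `σ ⊆ ℝ¹` for `P ∈ (ℚ̄ ∩ ℝ)[X]`: induction on `P`, the
coefficients being algebraic constants. [cite: BochnakCosteRoy1998, §2.2] -/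
theorem isSemialgebraicFunOn_aeval_apply {σ : Set (Fin 1 → ℝ)}
    (hσ : Literature.ModelTheory.ExponentialFields.IsSemialgebraic ℚ σ) (P : Polynomial (algebraicClosure ℚ ℝ)) :
    IsSemialgebraicFunOn ℚ σ (fun z => (Polynomial.aeval (z 0) P : ℝ)) := by
  induction P using Polynomial.induction_on' with
  | add p q hp hq =>
    refine (hp.fun_add hq).congr fun y _ => ?_
    simp
  | monomial n a =>
    refine ((isSemialgebraicFunOn_const_of_isAlgebraic hσ (mem_algebraicClosure_iff.1 a.2)).fun_mul
      ((isSemialgebraicFunOn_apply hσ 0).fun_pow n)).congr fun y _ => ?_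
    simp [Polynomial.aeval_monomial, IntermediateField.algebraMap_apply]

/-- A representation on a bounded cell `{z | z 0 ∈ (a, b)}` has its domain inside the compact segment
`{(t) | t ∈ [a, b]}` of `ℝ¹`. [folklore] -/
theorem domain_subset_image_Icc (r : KZ.IntegralRep 1) {a b : ℝ} (hdom : r.domain = {z | z 0 ∈ Set.Ioo a b}) :
    r.domain ⊆ (fun t : ℝ => fun _ : Fin 1 => t) '' Set.Icc a b := by
  intro z hz
  rw [hdom] at hz
  exact ⟨z 0, Ioo_subset_Icc_self hz, (KZ.eq_const_apply_zero z).symm⟩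

/-- **Splitting off the polynomial part of an oval cell** (rule 1b): a representation `r` on
`{z | z 0 ∈ (e₁, e₂)}` whose integrand is `P₁ + g` there is `[r₁] + [r₂]` modulo `M₁` with `r₁ = [∫ P₁]` and
`r₂ = [∫ g]` on the same cell. [cite: KontsevichZagier2001, §1.2 rule (1)] -/
theorem exists_split_poly (r : KZ.IntegralRep 1) {e₁ e₂ : ℝ} (hdom : r.domain = {z | z 0 ∈ Set.Ioo e₁ e₂})
    (P₁ : Polynomial (algebraicClosure ℚ ℝ)) :
    ∃ r₁ r₂ : KZ.IntegralRep 1, r₁.domain = {z | z 0 ∈ Set.Ioo e₁ e₂} ∧ r₂.domain = {z | z 0 ∈ Set.Ioo e₁ e₂} ∧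
      (∀ x ∈ Set.Ioo e₁ e₂, r₁.integrand (fun _ => x) = Polynomial.aeval x P₁) ∧
      (∀ x ∈ Set.Ioo e₁ e₂, r₂.integrand (fun _ => x) = r.integrand (fun _ => x) - Polynomial.aeval x P₁) ∧
      KZ.of r - KZ.of r₁ - KZ.of r₂ ∈ M₁ := by
  have hσ := r.isSemialgebraic_domain
  have h₁sa : IsSemialgebraicFunOn ℚ r.domain (fun z => (Polynomial.aeval (z 0) P₁ : ℝ)) :=
    isSemialgebraicFunOn_aeval_apply hσ P₁
  have hcont : Continuous fun z : Fin 1 → ℝ => (Polynomial.aeval (z 0) P₁ : ℝ) := by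
    have h1 : Continuous fun z : Fin 1 → ℝ => z 0 := continuous_apply 0
    have h2 : Continuous fun t : ℝ => (Polynomial.aeval t P₁ : ℝ) := by
      have : (fun t : ℝ => (Polynomial.aeval t P₁ : ℝ)) =
          fun t => (P₁.map (algebraMap (algebraicClosure ℚ ℝ) ℝ)).eval t := by
        funext t; rw [Polynomial.eval_map, Polynomial.aeval_def]
      rw [this]
      exact Polynomial.continuous _
    exact h2.comp h1
  have hK : IsCompact ((fun t : ℝ => fun _ : Fin 1 => t) '' Set.Icc e₁ e₂) :=
    isCompact_Icc.image (continuous_pi fun _ => continuous_id)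
  have h₁int : IntegrableOn (fun z : Fin 1 → ℝ => (Polynomial.aeval (z 0) P₁ : ℝ)) r.domain :=
    (hcont.continuousOn.integrableOn_compact hK).mono_set (domain_subset_image_Icc r hdom)
  set r₁ : KZ.IntegralRep 1 := ⟨r.domain, fun z => (Polynomial.aeval (z 0) P₁ : ℝ), hσ, h₁sa, h₁int⟩ with hr₁
  set r₂ : KZ.IntegralRep 1 := ⟨r.domain, fun z => r.integrand z - (Polynomial.aeval (z 0) P₁ : ℝ), hσ,
    r.isSemialgebraicFunOn_integrand.fun_sub h₁sa, r.integrableOn.sub h₁int⟩ with hr₂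
  refine ⟨r₁, r₂, hdom, hdom, fun x _ => rfl, fun x _ => rfl, ?_⟩
  refine HomotopyInvariance.integrandAddRel_subset ⟨1, r, r₁, r₂, rfl, rfl, fun z _ => ?_, rfl⟩
  show r.integrand z = (Polynomial.aeval (z 0) P₁ : ℝ) + (r.integrand z - (Polynomial.aeval (z 0) P₁ : ℝ))
  ring

/-- **Stub `stub_loopCells`** (registered, lead) — CELLS of the loop layer: polynomial cells and branch cells stay, an oval cell
`P₁ + P₂√f + P₃/√f` on `(e₁, e₂)` splits (rule 1b) into the polynomial cell `P₁` and the odd oval cell `P₂√f + P₃/√f`.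
[cite: KontsevichZagier2001, §1.2 rule (1)] -/
theorem stub_loopCells : ∀ (k : ℕ) (A B : Fin k → ℝ), (∀ j, IsAlgebraic ℚ (A j)) → (∀ j, IsAlgebraic ℚ (B j)) →
    ∀ c : KZ.FormalRep, c ∈ AddSubgroup.closure ((fun r : KZ.IntegralRep 1 => KZ.of r) ''
      {r | (∃ a b : ℝ, IsAlgebraic ℚ a ∧ IsAlgebraic ℚ b ∧ a < b ∧ r.domain = {z | z 0 ∈ Set.Ioo a b} ∧
            ∃ P : Polynomial (algebraicClosure ℚ ℝ), ∀ x ∈ Set.Ioo a b, r.integrand (fun _ => x) = Polynomial.aeval x P) ∨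
        (∃ j, ∃ e₁ e₂ : ℝ, IsAlgebraic ℚ e₁ ∧ IsAlgebraic ℚ e₂ ∧ e₁ < e₂ ∧ e₁ ^ 3 + A j * e₁ + B j = 0 ∧
          e₂ ^ 3 + A j * e₂ + B j = 0 ∧ (∀ x ∈ Set.Ioo e₁ e₂, 0 < x ^ 3 + A j * x + B j) ∧
          r.domain = {z | z 0 ∈ Set.Ioo e₁ e₂} ∧
          ∃ P₁ P₂ P₃ : Polynomial (algebraicClosure ℚ ℝ), ∀ x ∈ Set.Ioo e₁ e₂,
            r.integrand (fun _ => x) = Polynomial.aeval x P₁ + Polynomial.aeval x P₂ * Real.sqrt (x ^ 3 + A j * x + B j) +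
              Polynomial.aeval x P₃ / Real.sqrt (x ^ 3 + A j * x + B j)) ∨
        (∃ j, ∃ e c₀ : ℝ, IsAlgebraic ℚ e ∧ IsAlgebraic ℚ c₀ ∧ e ^ 3 + A j * e + B j = 0 ∧
          (∀ x : ℝ, e < x → 0 < x ^ 3 + A j * x + B j) ∧ r.domain = {z | e < z 0} ∧
          ∀ z ∈ r.domain, r.integrand z = c₀ / Real.sqrt ((z 0) ^ 3 + A j * (z 0) + B j))}) →
    ∃ N : KZ.IntegralRep 1 →₀ ℤ, (∀ ρ ∈ N.support,
      (∃ a b : ℝ, IsAlgebraic ℚ a ∧ IsAlgebraic ℚ b ∧ a < b ∧ ρ.domain = {z | z 0 ∈ Set.Ioo a b} ∧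
            ∃ P : Polynomial (algebraicClosure ℚ ℝ), ∀ x ∈ Set.Ioo a b, ρ.integrand (fun _ => x) = Polynomial.aeval x P) ∨
        (∃ j, ∃ e₁ e₂ : ℝ, IsAlgebraic ℚ e₁ ∧ IsAlgebraic ℚ e₂ ∧ e₁ < e₂ ∧ e₁ ^ 3 + A j * e₁ + B j = 0 ∧
          e₂ ^ 3 + A j * e₂ + B j = 0 ∧ (∀ x ∈ Set.Ioo e₁ e₂, 0 < x ^ 3 + A j * x + B j) ∧
          ρ.domain = {z | z 0 ∈ Set.Ioo e₁ e₂} ∧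
          ∃ P₂ P₃ : Polynomial (algebraicClosure ℚ ℝ), ∀ x ∈ Set.Ioo e₁ e₂,
            ρ.integrand (fun _ => x) = Polynomial.aeval x P₂ * Real.sqrt (x ^ 3 + A j * x + B j) +
              Polynomial.aeval x P₃ / Real.sqrt (x ^ 3 + A j * x + B j)) ∨
        (∃ j, ∃ e c₀ : ℝ, IsAlgebraic ℚ e ∧ IsAlgebraic ℚ c₀ ∧ e ^ 3 + A j * e + B j = 0 ∧
          (∀ x : ℝ, e < x → 0 < x ^ 3 + A j * x + B j) ∧ ρ.domain = {z | e < z 0} ∧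
          ∀ z ∈ ρ.domain, ρ.integrand z = c₀ / Real.sqrt ((z 0) ^ 3 + A j * (z 0) + B j))) ∧
      c - N.sum (fun ρ m => m • KZ.of ρ) ∈ M₁ := by
  classical
  intro k A B _hA _hB c hc
  refine AddSubgroup.closure_induction (p := fun c _ => ∃ N : KZ.IntegralRep 1 →₀ ℤ, (∀ ρ ∈ N.support,
      (∃ a b : ℝ, IsAlgebraic ℚ a ∧ IsAlgebraic ℚ b ∧ a < b ∧ ρ.domain = {z | z 0 ∈ Set.Ioo a b} ∧
            ∃ P : Polynomial (algebraicClosure ℚ ℝ), ∀ x ∈ Set.Ioo a b, ρ.integrand (fun _ => x) = Polynomial.aeval x P) ∨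
        (∃ j, ∃ e₁ e₂ : ℝ, IsAlgebraic ℚ e₁ ∧ IsAlgebraic ℚ e₂ ∧ e₁ < e₂ ∧ e₁ ^ 3 + A j * e₁ + B j = 0 ∧
          e₂ ^ 3 + A j * e₂ + B j = 0 ∧ (∀ x ∈ Set.Ioo e₁ e₂, 0 < x ^ 3 + A j * x + B j) ∧
          ρ.domain = {z | z 0 ∈ Set.Ioo e₁ e₂} ∧
          ∃ P₂ P₃ : Polynomial (algebraicClosure ℚ ℝ), ∀ x ∈ Set.Ioo e₁ e₂,
            ρ.integrand (fun _ => x) = Polynomial.aeval x P₂ * Real.sqrt (x ^ 3 + A j * x + B j) +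
              Polynomial.aeval x P₃ / Real.sqrt (x ^ 3 + A j * x + B j)) ∨
        (∃ j, ∃ e c₀ : ℝ, IsAlgebraic ℚ e ∧ IsAlgebraic ℚ c₀ ∧ e ^ 3 + A j * e + B j = 0 ∧
          (∀ x : ℝ, e < x → 0 < x ^ 3 + A j * x + B j) ∧ ρ.domain = {z | e < z 0} ∧
          ∀ z ∈ ρ.domain, ρ.integrand z = c₀ / Real.sqrt ((z 0) ^ 3 + A j * (z 0) + B j))) ∧
      c - N.sum (fun ρ m => m • KZ.of ρ) ∈ M₁) ?_ ?_ ?_ ?_ hc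
  · -- generators
    rintro _ ⟨r, hr, rfl⟩
    rcases hr with hpoly | ⟨j, e₁, e₂, he₁, he₂, hlt, hf₁, hf₂, hpos, hdom, P₁, P₂, P₃, hint⟩ | hbranch
    · refine ⟨Finsupp.single r 1, fun ρ hρ => ?_, ?_⟩
      · rw [Finsupp.support_single _ one_ne_zero, Finset.mem_singleton] at hρ
        subst hρ
        exact Or.inl hpoly
      · rw [Finsupp.sum_single_index (zero_zsmul _), one_zsmul, sub_self]
        exact M₁.zero_mem
    · obtain ⟨r₁, r₂, hr₁dom, hr₂dom, hr₁int, hr₂int, hrel⟩ := exists_split_poly r hdom P₁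
      refine ⟨Finsupp.single r₁ 1 + Finsupp.single r₂ 1, fun ρ hρ => ?_, ?_⟩
      · rcases Finset.mem_union.mp (Finsupp.support_add hρ) with h | h
        · rw [Finsupp.support_single _ one_ne_zero, Finset.mem_singleton] at h
          subst h
          exact Or.inl ⟨e₁, e₂, he₁, he₂, hlt, hr₁dom, P₁, hr₁int⟩
        · rw [Finsupp.support_single _ one_ne_zero, Finset.mem_singleton] at h
          subst h
          refine Or.inr (Or.inl ⟨j, e₁, e₂, he₁, he₂, hlt, hf₁, hf₂, hpos, hr₂dom, P₂, P₃, fun x hx => ?_⟩)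
          rw [hr₂int x hx, hint x hx]
          ring
      · rw [Cells.combo_add, Finsupp.sum_single_index (zero_zsmul _), Finsupp.sum_single_index (zero_zsmul _),
          one_zsmul, one_zsmul, ← sub_sub]
        exact hrel
    · refine ⟨Finsupp.single r 1, fun ρ hρ => ?_, ?_⟩
      · rw [Finsupp.support_single _ one_ne_zero, Finset.mem_singleton] at hρ
        subst hρ
        exact Or.inr (Or.inr hbranch)
      · rw [Finsupp.sum_single_index (zero_zsmul _), one_zsmul, sub_self]
        exact M₁.zero_mem
  · exact ⟨0, by simp, by simp [M₁.zero_mem]⟩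
  · rintro c c' _ _ ⟨N, hN, hcN⟩ ⟨N', hN', hcN'⟩
    refine ⟨N + N', fun ρ hρ => ?_, ?_⟩
    · rcases Finset.mem_union.mp (Finsupp.support_add hρ) with h | h
      · exact hN ρ h
      · exact hN' ρ h
    · rw [Cells.combo_add]
      convert M₁.add_mem hcN hcN' using 1
      abel
  · rintro c _ ⟨N, hN, hcN⟩
    refine ⟨-N, fun ρ hρ => hN ρ (by simpa [Finsupp.support_neg] using hρ), ?_⟩
    rw [Cells.combo_neg]
    convert M₁.neg_mem hcN using 1
    abel

end LoopLayer

end Summit.KontsevichZagierPeriods.SymplecticScissors.RealOnePeriodRelations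

end
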